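import Literature.MathematicalPhysics.QuantumLattice.EmeryThreeBandClusterTrialCap
import Literature.MathematicalPhysics.QuantumLattice.FermionVacuumExtension
import Literature.MathematicalPhysics.QuantumLattice.EmeryThreeBandRingWindowFloor
import HarnessLib

/-!
# The three-band cluster trial cap, DEVICE-READY: a density matrix on the `3ab` PHYSICAL sites `Cu_{ab}O_{2ab}` of the block (no dummy orbitals)
# caps `emeryEnergyDensity θ ρ` by `(4ab)⁻¹ · Re tr(H^θ_{Cu_{ab}O_{2ab}} ρ_S)` at every `θ`

Topic `Literature/MathematicalPhysics/QuantumLattice` (family `hubbard`; crew hubbard-fast S2 (iv) «three-band Emery boxes»). `EmeryThreeBandClusterTrialCap`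
(this seat) caps the typed three-band density by the block trace of ONE even density matrix `ρ₀` on the aligned block `[0,2a)×[0,2b)` of the decorated
lattice — a block that contains `ab` DUMMY sites no term touches, doubling the orbital count a cluster device would have to carry (`2×2` cells: 16 sites
instead of 12). With the vacuum extension `ρ₀ = ρ_S ⊗ |∅⟩⟨∅|_dummies` (`FermionVacuumExtension`) the law descends to the physical sites:

* §1 `emeryPhysSites m` = the sites of the block off the dummy coset (`3·|Cell m|` of them, Cu/O_x/O_y), the dummy points of the block
  (`cellPos dummy + ℓ(pos k) ∈ block ∖ emeryPhysSites`), and SUPPORT: every interacting shape of every Emery atom / of `emeryInteraction θ` avoids the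
  dummy coset (`emeryAtoms_apply_eq_zero_of_not_subset_phys`, `emeryInteraction_apply_eq_zero_of_not_subset_phys`), so
  `H^θ_block = Γ(H^θ_S)` and `D_{a,block} = Γ(D_{a,S})`.
* §2 **`emeryEnergyDensity_le_physClusterTrace`**: for an even density matrix `ρ_S` on `S = emeryPhysSites m` with `Re tr(N_S ρ_S) = 4·|Cell m|·ρ`:
  `emeryEnergyDensity θ ρ ≤ (4|Cell m|)⁻¹ · Re tr(H^θ_S ρ_S)` for EVERY `θ`; **`emeryEnergyDensity_le_sum_physClusterTraces`**: the same as the affine function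
  `(4|Cell m|)⁻¹ Σ_a θ_a Re tr(D_{a,S} ρ_S)` of the couplings (fourteen cluster traces ⇒ caps on every coupling box by the vertex rule of `S2SeamEmeryCaps`).
  For `a = b = 2`: `S = Cu₄O₈`, 12 sites, the filling-`5/4` sector `(N↑,N↓) = (10,10)` has dimension `66² = 4356` — a rational near-ground vector `ψ` of the
  open cluster gives the cap `⟨ψ|H^θ_S|ψ⟩/(4ab)`, exactly computable.

Everything is PROVED (0 sorry); definition with body: `emeryPhysSites`. HONEST SCOPE: composition of the cap law with the vacuum-extension glue; no number.

## Tree / Mathlib search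

REUSED: `emeryEnergyDensity_le_clusterTrace`, `localHamiltonian_emeryInteraction`, `emeryAtoms_cases` (`EmeryThreeBandClusterTrialCap`); `vacExtend`,
`parityAut/posSemidef/trace_vacExtend`, `trace_nAt_compl_mul_vacExtend`, `trace_totalNumber_mul_vacExtend`, `trace_localHamiltonian_mul_vacExtend`
(`FermionVacuumExtension`); `exists_pair_of_sublatticeVectorHopping_apply_ne_zero`, `exists_singleton_of_sublatticeOnSite_apply_ne_zero`
(`EmeryThreeBandRingWindowFloor`); `alignedPeriods`, `latPt`, `cellPos_add_latPt_mem_halfOpenRect`, `card_cell_alignedPeriods_liebPeriods`, `cellPos_dummy`;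
`InCoset`, `liebPeriods`, `dummySite`, `cuSite/oxSite/oySite`, `ppVec`, `unitVec`.

## References

* D. Ruelle, *Statistical Mechanics: Rigorous Results* (1969), §3.3. [cite: Ruelle1969, §3.3]
* H. Araki, H. Moriya, Rev. Math. Phys. 15 (2003) 93, §11.1 Thm. 11.2. [cite: ArakiMoriya2003, §11.1 Theorem 11.2]
* E. Pavarini et al., Phys. Rev. Lett. 87 (2001) 047003, eq. (1). [cite: PavariniEtAl2001, eq. (1)]
-/

noncomputable section

open scoped ComplexOrder BigOperators
open Finset

namespace Literature.MathematicalPhysics.QuantumLattice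

open Matrix HubbardWave0 Literature.Probability.LatticeModels ThermodynamicLimit

namespace InfVolFermionState

/-! ### §1. The physical sites of the block and the support of the three-band terms -/

/-- **The physical sites of the aligned block** `[0,2(m₀+1)) × [0,2(m₁+1))`: its Cu, O_x, O_y sites (everything off the dummy coset `(1,1)+(2ℤ)²`).
[cite: PavariniEtAl2001, eq. (1)] -/
def emeryPhysSites (m : Fin 2 → ℕ) : Finset (Site 2) :=
  (halfOpenRect (alignedPeriods liebPeriods m)).filter fun y => ¬ InCoset liebPeriods dummySite y

/-- The physical sites lie in the block. [cite: PavariniEtAl2001, eq. (1)] -/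
theorem emeryPhysSites_subset (m : Fin 2 → ℕ) : emeryPhysSites m ⊆ halfOpenRect (alignedPeriods liebPeriods m) := Finset.filter_subset _ _

/-- Parity test: a point `x + u` with `x` in the coset of `c` is OFF the dummy coset as soon as one coordinate of `c + u` is even.
[cite: ArakiMoriya2003, §4.1 Def. 4.3] -/
private theorem not_inCoset_dummy {c x u : Site 2} (hx : InCoset liebPeriods c x) (i : Fin 2) (hi : (c i + u i) % 2 = 0) :
    ¬ InCoset liebPeriods dummySite (x + u) := by
  intro h
  have h1 := hx i
  have h2 := h i
  have hq : ((liebPeriods i : ℕ) : ℤ) + 1 = 2 := liebPeriods_add_one i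
  have hd : (dummySite : Site 2) i = 1 := by fin_cases i <;> simp [dummySite, unitVec]
  rw [hq] at h1 h2
  rw [hd, Pi.add_apply] at h2
  omega

/-- The same for the root itself (`u = 0`). [cite: ArakiMoriya2003, §4.1 Def. 4.3] -/
private theorem not_inCoset_dummy₀ {c x : Site 2} (hx : InCoset liebPeriods c x) (i : Fin 2) (hi : c i % 2 = 0) :
    ¬ InCoset liebPeriods dummySite x := by
  have h := not_inCoset_dummy (u := 0) hx i (by simpa using hi)
  rwa [add_zero] at h

/-- **Every site of an interacting shape of a sublattice HOPPING atom rooted on Cu / O_x / O_y along a three-band bond vector is physical.** Packaged: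
if `Φ X ≠ 0` for `sublatticeVectorHopping liebPeriods c v 1` and both `c` and `c + v` have an even coordinate, no point of `X` is a dummy.
[cite: PavariniEtAl2001, eq. (1)] -/
private theorem forall_not_dummy_of_hopping {c v : Site 2} (hv : v ≠ 0) (i j : Fin 2) (hi : c i % 2 = 0) (hj : (c j + v j) % 2 = 0)
    {X : Finset (Site 2)} (h : (sublatticeVectorHopping liebPeriods c v 1).Φ X ≠ 0) : ∀ y ∈ X, ¬ InCoset liebPeriods dummySite y := by
  obtain ⟨x, rfl, hc⟩ := exists_pair_of_sublatticeVectorHopping_apply_ne_zero liebPeriods c hv 1 h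
  intro y hy
  rcases Finset.mem_insert.1 hy with rfl | hy
  · exact not_inCoset_dummy₀ hc i hi
  · rw [Finset.mem_singleton.1 hy]; exact not_inCoset_dummy hc j hj

/-- The on-site case. [cite: PavariniEtAl2001, eq. (1)] -/
private theorem forall_not_dummy_of_onSite {c : Site 2} (ε U : ℝ) (i : Fin 2) (hi : c i % 2 = 0)
    {X : Finset (Site 2)} (h : (sublatticeOnSite liebPeriods c ε U).Φ X ≠ 0) : ∀ y ∈ X, ¬ InCoset liebPeriods dummySite y := by
  obtain ⟨x, rfl, hc⟩ := exists_singleton_of_sublatticeOnSite_apply_ne_zero liebPeriods c ε U h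
  intro y hy
  rw [Finset.mem_singleton.1 hy]
  exact not_inCoset_dummy₀ hc i hi

/-- **No Emery atom touches the dummy sublattice**: if `(emeryAtoms a).Φ X ≠ 0` then no point of `X` is on the dummy coset. [cite: PavariniEtAl2001, eq. (1)] -/
theorem forall_not_inCoset_dummy_of_emeryAtoms_apply_ne_zero (a : Fin 14) {X : Finset (Site 2)} (h : (emeryAtoms a).Φ X ≠ 0) :
    ∀ y ∈ X, ¬ InCoset liebPeriods dummySite y := by
  have hcu : (cuSite : Site 2) 0 % 2 = 0 := by simp [cuSite]
  have hox : (oxSite : Site 2) 1 % 2 = 0 := by simp [oxSite, unitVec]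
  have hoy : (oySite : Site 2) 0 % 2 = 0 := by simp [oySite, unitVec]
  fin_cases a
  · exact forall_not_dummy_of_hopping (uvec_ne_zero 0) 0 1 hcu (by simp [cuSite]) h
  · exact forall_not_dummy_of_hopping (uvec_ne_zero 0) 1 1 hox (by simp [oxSite, unitVec]) h
  · exact forall_not_dummy_of_hopping (uvec_ne_zero 1) 0 0 hcu (by simp [cuSite]) h
  · exact forall_not_dummy_of_hopping (uvec_ne_zero 1) 0 0 hoy (by simp [oySite, unitVec]) h
  · exact forall_not_dummy_of_hopping (ppVec_ne_zero 0) 1 0 hox (by simp [oxSite, unitVec, ppVec]) h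
  · exact forall_not_dummy_of_hopping (ppVec_ne_zero 1) 1 0 hox (by simp [oxSite, unitVec, ppVec]) h
  · exact forall_not_dummy_of_hopping (ppVec_ne_zero 2) 1 0 hox (by simp [oxSite, unitVec, ppVec]) h
  · exact forall_not_dummy_of_hopping (ppVec_ne_zero 3) 1 0 hox (by simp [oxSite, unitVec, ppVec]) h
  · exact forall_not_dummy_of_onSite 1 0 0 hcu h
  · exact forall_not_dummy_of_onSite 1 0 1 hox h
  · exact forall_not_dummy_of_onSite 1 0 0 hoy h
  · exact forall_not_dummy_of_onSite 0 1 0 hcu h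
  · exact forall_not_dummy_of_onSite 0 1 1 hox h
  · exact forall_not_dummy_of_onSite 0 1 0 hoy h

/-- **SUPPORT of the atoms**: a term of an Emery atom inside the block that leaves the physical sites vanishes. [cite: PavariniEtAl2001, eq. (1)] -/
theorem emeryAtoms_apply_eq_zero_of_not_subset_phys (m : Fin 2 → ℕ) (a : Fin 14) {X : Finset (Site 2)}
    (hX : X ⊆ halfOpenRect (alignedPeriods liebPeriods m)) (hXS : ¬ X ⊆ emeryPhysSites m) : (emeryAtoms a).Φ X = 0 := by
  by_contra h
  exact hXS fun y hy => Finset.mem_filter.2 ⟨hX hy, forall_not_inCoset_dummy_of_emeryAtoms_apply_ne_zero a h y hy⟩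

/-- **SUPPORT of the interaction**: a term of `emeryInteraction θ` inside the block that leaves the physical sites vanishes. [cite: PavariniEtAl2001, eq. (1)] -/
theorem emeryInteraction_apply_eq_zero_of_not_subset_phys (m : Fin 2 → ℕ) (θ : Fin 14 → ℝ) {X : Finset (Site 2)}
    (hX : X ⊆ halfOpenRect (alignedPeriods liebPeriods m)) (hXS : ¬ X ⊆ emeryPhysSites m) : (emeryInteraction θ).Φ X = 0 := by
  rw [emeryInteraction, FermionInteraction.linearFamily_apply, hubbardFermionInteraction_zero_zero_apply, zero_add]
  exact Finset.sum_eq_zero fun a _ => by rw [emeryAtoms_apply_eq_zero_of_not_subset_phys m a hX hXS, smul_zero]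

/-- **The dummy points of the block lie in the block but off the physical sites.** [cite: PavariniEtAl2001, eq. (1)] -/
theorem dummyPoint_mem_sdiff (m : Fin 2 → ℕ) (k : Cell m) :
    cellPos (fun i => Fin.last (liebPeriods i) : Cell liebPeriods) + latPt liebPeriods m k ∈
      halfOpenRect (alignedPeriods liebPeriods m) \ emeryPhysSites m := by
  refine Finset.mem_sdiff.2 ⟨cellPos_add_latPt_mem_halfOpenRect liebPeriods m _ k, fun h => (Finset.mem_filter.1 h).2 ?_⟩
  rw [cellPos_dummy]
  intro i
  have hq : ((liebPeriods i : ℕ) : ℤ) + 1 = 2 := liebPeriods_add_one i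
  rw [hq, Pi.add_apply, add_sub_cancel_left, latPt_apply, hq]
  exact Int.mul_emod_left _ _

/-! ### §2. The device-ready cap -/

section Cap

variable (m : Fin 2 → ℕ) (ρS : FermionOp (emeryPhysSites m)) (hev : parityAut ρS = ρS) (hpsd : ρS.PosSemidef) (htr : ρS.trace = 1)

include hev hpsd htr in
/-- **THE THREE-BAND CLUSTER TRIAL CAP ON THE PHYSICAL SITES.** For an even density matrix `ρ_S` on the `3ab` physical sites `S = Cu_{ab}O_{2ab}` of the
block (`m = (a−1, b−1)`) with `Re tr(N_S ρ_S) = 4ab·ρ`: `emeryEnergyDensity θ ρ ≤ (4ab)⁻¹ · Re tr(H^θ_S ρ_S)` at EVERY coupling vector `θ`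
(`H^θ_S = (emeryInteraction θ).localHamiltonian S`, the open-cluster three-band Hamiltonian). [cite: Ruelle1969, §3.3] [cite: ArakiMoriya2003, §11.1 Theorem 11.2] -/
theorem emeryEnergyDensity_le_physClusterTrace {ρ : ℝ}
    (hN : ((totalNumber : FermionOp (emeryPhysSites m)) * ρS).trace.re = 4 * Fintype.card (Cell m) * ρ) (θ : Fin 14 → ℝ) :
    emeryEnergyDensity θ ρ ≤
      (Fintype.card (Cell (alignedPeriods liebPeriods m)) : ℝ)⁻¹ *
        ((emeryInteraction θ).localHamiltonian (emeryPhysSites m) * ρS).trace.re := by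
  have hS := emeryPhysSites_subset m
  have h := emeryEnergyDensity_le_clusterTrace m (vacExtend hS ρS) (parityAut_vacExtend hS hev) (posSemidef_vacExtend hS hpsd)
    (by rw [trace_vacExtend, htr]) (ρ := ρ) (fun k => by rw [trace_nAt_compl_mul_vacExtend hS (dummyPoint_mem_sdiff m k), Complex.zero_re])
    (by rw [trace_totalNumber_mul_vacExtend, hN]) θ
  rwa [(emeryInteraction θ).trace_localHamiltonian_mul_vacExtend hS
    (fun X hX hXS => emeryInteraction_apply_eq_zero_of_not_subset_phys m θ hX hXS)] at h

include hev hpsd htr in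
/-- **THE CAP AS AN AFFINE FUNCTION OF THE COUPLINGS, on the physical sites**: `emeryEnergyDensity θ ρ ≤ (4ab)⁻¹ Σ_a θ_a · Re tr(D_{a,S} ρ_S)` — fourteen
open-cluster traces of ONE state cap the three-band energy on every coupling box. [cite: Ruelle1969, §3.3] -/
theorem emeryEnergyDensity_le_sum_physClusterTraces {ρ : ℝ}
    (hN : ((totalNumber : FermionOp (emeryPhysSites m)) * ρS).trace.re = 4 * Fintype.card (Cell m) * ρ) (θ : Fin 14 → ℝ) :
    emeryEnergyDensity θ ρ ≤
      (Fintype.card (Cell (alignedPeriods liebPeriods m)) : ℝ)⁻¹ *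
        ∑ a, θ a * ((emeryAtoms a).localHamiltonian (emeryPhysSites m) * ρS).trace.re := by
  have h := emeryEnergyDensity_le_physClusterTrace m ρS hev hpsd htr hN θ
  rw [localHamiltonian_emeryInteraction, Finset.sum_mul, Matrix.trace_sum, Complex.re_sum] at h
  simp only [Matrix.smul_mul, Matrix.trace_smul, smul_eq_mul, Complex.re_ofReal_mul] at h
  exact h

/-- The block has `4·|Cell m|` lattice sites: the normalisation of the cap per decorated cell is `(4ab)⁻¹`. [cite: ArakiMoriya2003, §4.1 Def. 4.3] -/
theorem card_cell_block_eq (m : Fin 2 → ℕ) : (Fintype.card (Cell (alignedPeriods liebPeriods m)) : ℝ) = 4 * Fintype.card (Cell m) := by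
  rw [card_cell_alignedPeriods_liebPeriods]; push_cast; ring

end Cap

end InfVolFermionState

end Literature.MathematicalPhysics.QuantumLattice

end
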